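import Literature.Barriers.CriticalPhenomena.WeaklySAWPerturbativeEtaTheta
import Literature.Barriers.CriticalPhenomena.RigorousRGSmallParameterFRDGradientScaleBounds
import HarnessLib

/-!
# BBS-rg-pt, Lemma 6.1.2 for `π_j = 2L^{2(j+1)}δ[(wΔw)^{(1)}]` of the weakly self-avoiding walk
# (`d = 4`): the lattice Laplacian on the decomposition, summation by parts, and `|π_j| ≤ K_L ϑ_j`

Companion of `WeaklySAWPerturbativeCoefficients.lean` (`π'_j = 2δ[(wΔw)^{(1)}]`, `π_j = L^{2(j+1)}π'_j`,
the Laplacian `lapl`) and `WeaklySAWPerturbativeEtaTheta.lean` (the counting for `η_j`, `θ_j`).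
Source: R. Bauerschmidt, D. C. Brydges, G. Slade, *A renormalisation group method. III. Perturbative
analysis*, J. Stat. Phys. **159** (2015), arXiv:1403.7252 [BBS-rg-pt], Lemma 6.1.2
(`π'_j = O(L^{-(d-2)j}(1+m²L^{2j})^{-k})`) and its proof: "We use the uniform bounds (scaling-estimate)
extensively … With the finite-range property, they imply
`|∇ˡC_{j,x}|, |∇ˡC_{j+1,x}| ≤ O(M_jL^{-(d-2)j}L^{-lj})𝟙_{|x|≤O(L^j)}`, `l = 0,1,2`", quoted in
Bauerschmidt–Brydges–Slade, CMP 337 (2015) [BBS2015], §6.1 as Assumption (A2) ("each of `θ_j`, `η_j`,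
`ξ_j`, and `π_j` is bounded in absolute value by `O(χ_j)`"). The second differences of the explicit
decomposition are the tree's `FRD.abs_latGrad_Gam_le_of_three_le` (BBS (3.12), `|a| = 2`).

## What this file proves (everything; no definition, no named fact)

* `lapl_eq_neg_sum_latGrad` — `Δq = -Σ_i∇^{e_i}∇^{-e_i}q`; `abs_lapl_Gam_four_le_decay`,
  `abs_lapl_Gam_four_le` — `|ΔC_{j+1;0,x}| ≤ cϑ_j/L^{4j}` (`m² > 0`) and `≤ c/L^{4j}` (`m² ≥ 0`);
* summation by parts on `ℤ^d`: `tsum_mul_shift`, **`tsum_mul_lapl_comm`** (`Σ_xf(Δg) = Σ_xg(Δf)` for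
  finitely supported `f, g`), `tsum_mul_lapl_add_left/right`;
* **`piPrimePT_eq`** — `π'_j = 2(2Σ_xw_j(ΔC_{j+1}) + Σ_xC_{j+1}(ΔC_{j+1}))` (the Laplacian moved onto
  the top scale), as finite sums;
* `abs_piPT_le_core`, **`abs_piPT_le`**, **`abs_piPT_le_decay`** — `|π_j| ≤ KL⁶` for all `m² ≥ 0`,
  `j`, and `|π_j| ≤ KL⁶ϑ_j` for `m² > 0` (`ϑ_j = (1+L^{2j}m²/(8+m²))^{-p}`, every `p`).
-/

noncomputable section

open Set Filter Topology
open Literature.Probability.LatticeModels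
open scoped BigOperators

namespace Literature.Barriers.CriticalPhenomena

namespace CTWSAW

open LongRangePhi4 LongRangePhi4.FRD PT

variable {d : ℕ}

/-! ### The Laplacian through second differences -/

/-- `Δq = -Σ_i∇^{e_i}∇^{-e_i}q` (`∇^{[e,e']}` the tree's iterated difference `latGrad`). [folklore] -/
theorem lapl_eq_neg_sum_latGrad (q : Site d → ℝ) (x : Site d) :
    lapl q x = -∑ i : Fin d, latGrad [Pi.single i 1, -Pi.single i 1] q x := by
  unfold lapl
  rw [← Finset.sum_neg_distrib]
  refine Finset.sum_congr rfl fun i _ => ?_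
  simp only [latGrad_cons, latGrad_nil]
  rw [add_neg_cancel_right, sub_eq_add_neg x]
  ring

/-- The unit steps `±e_i` have `Σ_k|e_k| ≤ 1`. [folklore] -/
theorem sum_abs_single_le (i : Fin d) (a : ℤ) (ha : |a| ≤ 1) :
    (∑ k, |(((Pi.single i a : Site d) k : ℤ) : ℝ)|) ≤ 1 := by
  rw [Finset.sum_eq_single i]
  · simp only [Pi.single_eq_same]
    rw [← Int.cast_abs]
    exact_mod_cast ha
  · intro k _ hk; simp [Pi.single_eq_of_ne hk]
  · intro h; exact absurd (Finset.mem_univ i) h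

/-- **`|ΔC_{j+1;0,x}| ≤ cϑ_j/L^{4j}`** for `m² = s > 0`, `L ≥ 2`, all `j`, `x` (`d = 4`; every `p`):
the second-difference scaling estimate `|∇²C_{j+1}| ≤ c(1/(8+s))ϑ_j(L^j)²/(L^j)⁶`.
[cite: BauerschmidtBrydgesSlade2015LogCorr, §5.2 (display (scaling-estimate) with |α|₁ = 2, d = 4)] -/
theorem abs_lapl_Gam_four_le_decay (p : ℕ) : ∃ c : ℝ, 0 < c ∧ ∀ L : ℝ, 2 ≤ L → ∀ s : ℝ, 0 < s →
    ∀ j : ℕ, ∀ x : Site 4,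
      |lapl (Gam 4 L s (j + 1)) x| ≤ c * ((1 + L ^ (2 * j) * s / (8 + s)) ^ p)⁻¹ / L ^ (4 * j) := by
  obtain ⟨c, hc, h⟩ := abs_latGrad_Gam_le_of_three_le (d := 4) (by norm_num) 2 p (by norm_num)
  refine ⟨4 * c, by positivity, fun L hL s hs j x => ?_⟩
  have hL0 : (0 : ℝ) < L := by linarith
  set ϑ : ℝ := ((1 + L ^ (2 * j) * s / (8 + s)) ^ p)⁻¹ with hϑ
  have hterm : ∀ i : Fin 4, |latGrad [Pi.single i 1, -Pi.single i 1] (Gam 4 L s (j + 1)) x| ≤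
      c * ϑ / L ^ (4 * j) := by
    intro i
    have hl : ∀ e ∈ [(Pi.single i 1 : Site 4), -Pi.single i 1], (∑ k, |((e k : ℤ) : ℝ)|) ≤ 1 := by
      intro e he
      simp only [List.mem_cons, List.mem_nil_iff, or_false] at he
      rcases he with rfl | rfl
      · exact sum_abs_single_le i 1 (by norm_num)
      · have : -(Pi.single i (1 : ℤ) : Site 4) = Pi.single i (-1) := by
          ext k; by_cases hk : k = i
          · subst hk; simp
          · simp [Pi.single_eq_of_ne hk]
        rw [this]; exact sum_abs_single_le i (-1) (by norm_num)
    have := h _ (by simp) hl L hL s hs (j + 1) (by omega) x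
    rw [Nat.add_sub_cancel] at this
    refine this.trans ?_
    have e2 : (L ^ j) ^ 2 = L ^ (2 * j) := by rw [← pow_mul, mul_comm]
    have e6 : (L ^ j) ^ 2 / (L ^ j) ^ (4 + 2) = 1 / L ^ (4 * j) := by
      rw [show (4 + 2 : ℕ) = 2 + 4 by norm_num, pow_add, div_mul_eq_div_div, div_self (pow_ne_zero _ (pow_ne_zero _ hL0.ne')),
        ← pow_mul, mul_comm j 4]
    rw [e6, e2, show (2 * ((4 : ℕ) : ℝ) + s) = 8 + s by norm_num]
    have hfrac : 1 / (8 + s) ≤ 1 := by rw [div_le_one (by positivity)]; linarith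
    have hϑ0 : 0 ≤ ϑ := by positivity
    calc c * (1 / (8 + s) * ϑ) * (1 / L ^ (4 * j)) ≤ c * (1 * ϑ) * (1 / L ^ (4 * j)) := by gcongr
      _ = c * ϑ / L ^ (4 * j) := by ring
  rw [lapl_eq_neg_sum_latGrad, abs_neg]
  calc |∑ i : Fin 4, latGrad [Pi.single i 1, -Pi.single i 1] (Gam 4 L s (j + 1)) x|
      ≤ ∑ i : Fin 4, |latGrad [Pi.single i 1, -Pi.single i 1] (Gam 4 L s (j + 1)) x| :=
        Finset.abs_sum_le_sum_abs _ _
    _ ≤ ∑ _i : Fin 4, c * ϑ / L ^ (4 * j) := Finset.sum_le_sum fun i _ => hterm i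
    _ = 4 * c * ϑ / L ^ (4 * j) := by simp; ring

/-- `s ↦ (ΔC_{j+1}(·;s))_x` is right-continuous at `s = 0`. [folklore] -/
theorem tendsto_lapl_Gam_mass (hd : 1 ≤ d) {L : ℝ} (hL : 0 ≤ L) (j : ℕ) (x : Site d) :
    Tendsto (fun s => lapl (Gam d L s j) x) (𝓝[>] 0) (𝓝 (lapl (Gam d L 0 j) x)) := by
  unfold lapl
  refine tendsto_finsetSum _ fun i _ => ?_
  exact ((tendsto_Gam_mass hd hL j _).add (tendsto_Gam_mass hd hL j _)).sub
    ((tendsto_Gam_mass hd hL j _).const_mul 2)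

/-- **`|ΔC_{j+1;0,x}| ≤ c/L^{4j}`** for all `m² ≥ 0` (`d = 4`, `L ≥ 2`), the value `m² = 0` by
right-continuity. [cite: BauerschmidtBrydgesSlade2015LogCorr, §5.2 (scaling estimate, |α|₁ = 2) and §6.1 ([BBS-rg-pt] Lemma 6.1.2, proof: display (Cconcl), l = 2)] -/
theorem abs_lapl_Gam_four_le : ∃ c : ℝ, 0 < c ∧ ∀ L : ℝ, 2 ≤ L → ∀ s : ℝ, 0 ≤ s →
    ∀ j : ℕ, ∀ x : Site 4, |lapl (Gam 4 L s (j + 1)) x| ≤ c / L ^ (4 * j) := by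
  obtain ⟨c, hc, h⟩ := abs_lapl_Gam_four_le_decay 0
  refine ⟨c, hc, fun L hL s hs j x => ?_⟩
  have hpos : ∀ s : ℝ, 0 < s → |lapl (Gam 4 L s (j + 1)) x| ≤ c / L ^ (4 * j) := by
    intro s hs
    have := h L hL s hs j x
    simpa using this
  rcases hs.lt_or_eq with hs' | hs'
  · exact hpos s hs'
  · rw [← hs']
    have hT := tendsto_lapl_Gam_mass (d := 4) (by norm_num) (by linarith : (0 : ℝ) ≤ L) (j + 1) x
    refine le_of_tendsto ((continuous_abs.tendsto _).comp hT) ?_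
    filter_upwards [self_mem_nhdsWithin] with s hs using hpos s hs

/-! ### Summation by parts on `ℤ^d` -/

/-- `Σ_xf(x)g(x+e) = Σ_xf(x-e)g(x)` (translation invariance of `Σ_{x∈ℤ^d}`). [folklore] -/
theorem tsum_mul_shift (f g : Site d → ℝ) (e : Site d) :
    ∑' x, f x * g (x + e) = ∑' x, f (x - e) * g x := by
  rw [← (Equiv.addRight e).tsum_eq (fun x => f (x - e) * g x)]
  simp

/-- A finitely supported function on `ℤ^d` is summable. [folklore] -/
theorem summable_of_support_subset {f : Site d → ℝ} {S : Finset (Site d)} (hf : ∀ x ∉ S, f x = 0) :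
    Summable f :=
  summable_of_ne_finset_zero hf

/-- **Summation by parts for the lattice Laplacian**: `Σ_xf_x(Δg)_x = Σ_xg_x(Δf)_x` for finitely
supported `f, g`. [folklore] -/
theorem tsum_mul_lapl_comm {f g : Site d → ℝ} {S : Finset (Site d)} (hf : ∀ x ∉ S, f x = 0)
    (hg : ∀ x ∉ S, g x = 0) : ∑' x, f x * lapl g x = ∑' x, g x * lapl f x := by
  classical
  -- summability of all the pieces (supports inside `S`)
  have hs : ∀ (u v : Site d → ℝ), (∀ x ∉ S, u x = 0) → ∀ e : Site d, Summable fun x => u x * v (x + e) :=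
    fun u v hu e => summable_of_support_subset (S := S) fun x hx => by rw [hu x hx, zero_mul]
  have hs0 : ∀ (u v : Site d → ℝ), (∀ x ∉ S, u x = 0) → Summable fun x => u x * v x :=
    fun u v hu => by simpa using hs u v hu 0
  -- expand both sides
  have expand : ∀ (u v : Site d → ℝ), (∀ x ∉ S, u x = 0) →
      ∑' x, u x * lapl v x = ∑ i : Fin d, ((∑' x, u x * v (x + Pi.single i 1)) +
        (∑' x, u x * v (x - Pi.single i 1)) - 2 * ∑' x, u x * v x) := by
    intro u v hu
    have h1 : ∀ x, u x * lapl v x = ∑ i : Fin d, (u x * v (x + Pi.single i 1) +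
        u x * v (x - Pi.single i 1) - 2 * (u x * v x)) := fun x => by
      unfold lapl; rw [Finset.mul_sum]; exact Finset.sum_congr rfl fun i _ => by ring
    simp_rw [h1]
    rw [Summable.tsum_finsetSum (fun i _ => ((hs u v hu _).add (by
      simpa [sub_eq_add_neg] using hs u v hu (-Pi.single i 1))).sub ((hs0 u v hu).mul_left 2))]
    refine Finset.sum_congr rfl fun i _ => ?_
    rw [Summable.tsum_sub ((hs u v hu _).add (by simpa [sub_eq_add_neg] using hs u v hu (-Pi.single i 1)))
      ((hs0 u v hu).mul_left 2), Summable.tsum_add (hs u v hu _)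
      (by simpa [sub_eq_add_neg] using hs u v hu (-Pi.single i 1)), tsum_mul_left]
  rw [expand f g hf, expand g f hg]
  refine Finset.sum_congr rfl fun i _ => ?_
  -- `Σf(x)g(x+e) = Σg(x)f(x-e)` and `Σf(x)g(x-e) = Σg(x)f(x+e)`
  have hA : ∑' x, f x * g (x + Pi.single i 1) = ∑' x, g x * f (x - Pi.single i 1) := by
    rw [tsum_mul_shift]; exact tsum_congr fun x => mul_comm _ _
  have hB : ∑' x, f x * g (x - Pi.single i 1) = ∑' x, g x * f (x + Pi.single i 1) := by
    have := tsum_mul_shift f g (-Pi.single i 1)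
    simp only [← sub_eq_add_neg, sub_neg_eq_add] at this
    rw [this]; exact tsum_congr fun x => mul_comm _ _
  have hC : ∑' x, f x * g x = ∑' x, g x * f x := tsum_congr fun x => mul_comm _ _
  rw [hA, hB, hC]
  ring

/-- Additivity of `Σ_xu(Δv)` in the first slot (finite supports). [folklore] -/
theorem tsum_add_mul_lapl {u₁ u₂ v : Site d → ℝ} {S : Finset (Site d)} (h₁ : ∀ x ∉ S, u₁ x = 0)
    (h₂ : ∀ x ∉ S, u₂ x = 0) :
    ∑' x, (u₁ x + u₂ x) * lapl v x = (∑' x, u₁ x * lapl v x) + ∑' x, u₂ x * lapl v x := by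
  simp_rw [add_mul]
  exact Summable.tsum_add (summable_of_support_subset (S := S) fun x hx => by rw [h₁ x hx, zero_mul])
    (summable_of_support_subset (S := S) fun x hx => by rw [h₂ x hx, zero_mul])

/-- `Δ` is additive. [folklore] -/
theorem lapl_add (u v : Site d → ℝ) (x : Site d) : lapl (fun y => u y + v y) x = lapl u x + lapl v x := by
  unfold lapl; rw [← Finset.sum_add_distrib]; exact Finset.sum_congr rfl fun i _ => by ring

/-! ### `π'_j` with the Laplacian on the top scale -/

/-- **`π'_j = 2(2Σ_xw_{j,x}(ΔC_{j+1})_x + Σ_xC_{j+1,x}(ΔC_{j+1})_x)`** as finite sums over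
`|x|₁ < ½L^{j+1}` (`d ≥ 1`, `L ≥ 1`, `m² ≥ 0`): `δ[(wΔw)^{(1)}] = (w,ΔC) + (C,Δw) + (C,ΔC)` and
`(C,Δw) = (w,ΔC)` by summation by parts.
[cite: BauerschmidtBrydgesSlade2015LogCorr, §6.1 ([BBS-rg-pt] §3.6, π' = 2δ[(wΔw)^{(1)}]; Lemma 6.1.2, proof)] -/
theorem piPrimePT_eq (hd : 1 ≤ d) {L : ℝ} (hL : 1 ≤ L) {s : ℝ} (hs : 0 ≤ s) (j : ℕ) :
    piPrimePT d L s j = 2 * (2 * ∑ x ∈ PT.ball (L ^ (j + 1) / 2), covSum d L s j x * lapl (Gam d L s (j + 1)) x +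
      ∑ x ∈ PT.ball (L ^ (j + 1) / 2), Gam d L s (j + 1) x * lapl (Gam d L s (j + 1)) x) := by
  classical
  set S : Finset (Site d) := PT.ball (L ^ (j + 1) / 2) with hSdef
  set W : Site d → ℝ := covSum d L s j
  set G : Site d → ℝ := Gam d L s (j + 1)
  have hL0 : (0 : ℝ) ≤ L := by linarith
  have hWS : ∀ x ∉ S, W x = 0 := by
    intro x hx
    rw [hSdef, PT.mem_ball, not_lt] at hx
    have : L ^ j / 2 ≤ L ^ (j + 1) / 2 :=
      div_le_div_of_nonneg_right (pow_le_pow_right₀ hL (Nat.le_succ j)) (by norm_num)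
    exact covSum_eq_zero hd hL hs (this.trans hx)
  have hGS : ∀ x ∉ S, G x = 0 := by
    intro x hx
    rw [hSdef, PT.mem_ball, not_lt] at hx
    exact Gam_eq_zero hd hL0 hs (j + 1) x hx
  have hW1 : covSum d L s (j + 1) = fun x => W x + G x := funext fun x => covSum_succ L s j x
  -- `(w+C, Δ(w+C)) = (w,Δw) + (w,ΔC) + (C,Δw) + (C,ΔC)`
  have hsplit : ∑' x, covSum d L s (j + 1) x * lapl (covSum d L s (j + 1)) x =
      (∑' x, W x * lapl W x) + (∑' x, W x * lapl G x) + ((∑' x, G x * lapl W x) + ∑' x, G x * lapl G x) := by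
    rw [hW1]
    have e1 : (fun x => (W x + G x) * lapl (fun y => W y + G y) x) =
        fun x => (W x + G x) * lapl W x + (W x + G x) * lapl G x := by
      funext x; rw [lapl_add]; ring
    rw [show (∑' x, (W x + G x) * lapl (fun y => W y + G y) x) =
        ∑' x, ((W x + G x) * lapl W x + (W x + G x) * lapl G x) by rw [e1]]
    have hsum1 : Summable fun x => (W x + G x) * lapl W x :=
      summable_of_support_subset (S := S) fun x hx => by rw [hWS x hx, hGS x hx, add_zero, zero_mul]
    have hsum2 : Summable fun x => (W x + G x) * lapl G x :=
      summable_of_support_subset (S := S) fun x hx => by rw [hWS x hx, hGS x hx, add_zero, zero_mul]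
    rw [Summable.tsum_add hsum1 hsum2, tsum_add_mul_lapl hWS hGS, tsum_add_mul_lapl hWS hGS]
    ring
  have hcomm : ∑' x, G x * lapl W x = ∑' x, W x * lapl G x := tsum_mul_lapl_comm hGS hWS
  unfold piPrimePT
  rw [hsplit, hcomm]
  have hfin1 : ∑' x, W x * lapl G x = ∑ x ∈ S, W x * lapl G x :=
    tsum_eq_sum fun x hx => by rw [hWS x hx, zero_mul]
  have hfin2 : ∑' x, G x * lapl G x = ∑ x ∈ S, G x * lapl G x :=
    tsum_eq_sum fun x hx => by rw [hGS x hx, zero_mul]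
  rw [hfin1, hfin2]
  ring

/-! ### The bound on `π_j` -/

/-- **The core bound on `π_j`** (`d = 4`, `L ≥ 2`, `m² = s ≥ 0`): if `|C_{j+1;0,x}| ≤ A` and
`|(ΔC_{j+1})_x| ≤ D` for all `x`, then `|π_j| ≤ 2L⁶(DL^{4j})(64c + 16AL^{2j})`
(`|w_j| ≤ Σ_{k<j}(c/L^{2k})𝟙_k`, `Σ_{k<j}Σ_x(c/L^{2k})𝟙_k ≤ 32cL⁴L^{2j}`, `16L⁴L^{4j}` points).
[cite: BauerschmidtBrydgesSlade2015LogCorr, §6.1 ([BBS-rg-pt] Lemma 6.1.2: π'_j = O(L^{-2j}M_j) at d = 4)] -/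
theorem abs_piPT_le_core {c : ℝ} (hc0 : 0 < c)
    (hc : ∀ L : ℝ, 2 ≤ L → ∀ s : ℝ, 0 ≤ s → ∀ i : ℕ, ∀ x : Site 4, |Gam 4 L s (i + 1) x| ≤ c / L ^ (2 * i))
    {L : ℝ} (hL : 2 ≤ L) {s : ℝ} (hs : 0 ≤ s) (j : ℕ) {A D : ℝ} (hA0 : 0 ≤ A) (hD0 : 0 ≤ D)
    (hA : ∀ x : Site 4, |Gam 4 L s (j + 1) x| ≤ A) (hD : ∀ x : Site 4, |lapl (Gam 4 L s (j + 1)) x| ≤ D) :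
    |piPT 4 L s j| ≤ 2 * L ^ 6 * (D * L ^ (4 * j)) * (64 * c + 16 * (A * L ^ (2 * j))) := by
  classical
  have hL1 : (1 : ℝ) ≤ L := by linarith
  have hL0 : (0 : ℝ) < L := by linarith
  set S : Finset (Site 4) := PT.ball (L ^ (j + 1) / 2) with hSdef
  set a : ℕ → ℝ := fun i => c / L ^ (2 * i) with ha
  set ind : ℕ → Site 4 → ℝ := fun i x => if x ∈ PT.ball (L ^ (i + 1) / 2) then (1 : ℝ) else 0
    with hind
  have ha0 : ∀ i, 0 ≤ a i := fun i => by simp only [ha]; positivity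
  have hW : ∀ x, |covSum 4 L s j x| ≤ ∑ k ∈ Finset.range j, a k * ind k x := fun x =>
    abs_covSum_four_le hc hL hs j x
  -- first sum: `|Σ_x w ΔC| ≤ D · 32cL⁴L^{2j}`
  have h1 : |∑ x ∈ S, covSum 4 L s j x * lapl (Gam 4 L s (j + 1)) x| ≤ D * (32 * c * L ^ 4 * L ^ (2 * j)) := by
    refine (Finset.abs_sum_le_sum_abs _ _).trans ?_
    have hpt : ∀ x ∈ S, |covSum 4 L s j x * lapl (Gam 4 L s (j + 1)) x| ≤
        D * ∑ k ∈ Finset.range j, a k * ind k x := by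
      intro x _
      rw [abs_mul, mul_comm]
      exact mul_le_mul (hD x) (hW x) (abs_nonneg _) hD0
    refine (Finset.sum_le_sum hpt).trans ?_
    rw [← Finset.mul_sum]
    refine mul_le_mul_of_nonneg_left ?_ hD0
    -- as in the bound on `β_j`
    rw [Finset.sum_comm]
    have hai : ∀ i, a i * (16 * L ^ 4 * L ^ (4 * i)) = 16 * c * L ^ 4 * L ^ (2 * i) := by
      intro i
      simp only [ha]
      have : L ^ (4 * i) = L ^ (2 * i) * L ^ (2 * i) := by rw [← pow_add]; ring_nf
      rw [this]
      field_simp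
    have hin : ∀ i ∈ Finset.range j, ∑ x ∈ S, a i * ind i x ≤ 16 * c * L ^ 4 * L ^ (2 * i) := by
      intro i _
      rw [← Finset.mul_sum, ← hai i]
      exact mul_le_mul_of_nonneg_left (sum_ball_indicator_le _ hL1 i) (ha0 i)
    refine (Finset.sum_le_sum hin).trans ?_
    rw [← Finset.mul_sum]
    have := geom_sum_sq_le hL j
    have k0 : 0 ≤ 16 * c * L ^ 4 := by positivity
    nlinarith [mul_le_mul_of_nonneg_left this k0]
  -- second sum: `|Σ_x C ΔC| ≤ 16L⁴L^{4j} A D`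
  have h2 : |∑ x ∈ S, Gam 4 L s (j + 1) x * lapl (Gam 4 L s (j + 1)) x| ≤ 16 * L ^ 4 * L ^ (4 * j) * (A * D) := by
    refine (Finset.abs_sum_le_sum_abs _ _).trans ?_
    have hpt : ∀ x ∈ S, |Gam 4 L s (j + 1) x * lapl (Gam 4 L s (j + 1)) x| ≤ A * D := by
      intro x _
      rw [abs_mul]
      exact mul_le_mul (hA x) (hD x) (abs_nonneg _) hA0
    refine (Finset.sum_le_sum hpt).trans ?_
    rw [Finset.sum_const, nsmul_eq_mul]
    exact mul_le_mul_of_nonneg_right (card_ball_four_le hL1 j) (by positivity)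
  -- assemble
  unfold piPT
  rw [piPrimePT_eq (by norm_num) hL1 hs j, abs_mul, abs_of_pos (pow_pos hL0 _), abs_mul, abs_two]
  have h3 : |2 * ∑ x ∈ S, covSum 4 L s j x * lapl (Gam 4 L s (j + 1)) x +
      ∑ x ∈ S, Gam 4 L s (j + 1) x * lapl (Gam 4 L s (j + 1)) x| ≤
      2 * (D * (32 * c * L ^ 4 * L ^ (2 * j))) + 16 * L ^ 4 * L ^ (4 * j) * (A * D) := by
    refine (abs_add_le _ _).trans (add_le_add ?_ h2)
    rw [abs_mul, abs_two]
    exact mul_le_mul_of_nonneg_left h1 (by norm_num)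
  have e : L ^ (2 * (j + 1)) = L ^ 2 * L ^ (2 * j) := by ring
  rw [e]
  calc L ^ 2 * L ^ (2 * j) * (2 * |2 * ∑ x ∈ S, covSum 4 L s j x * lapl (Gam 4 L s (j + 1)) x +
        ∑ x ∈ S, Gam 4 L s (j + 1) x * lapl (Gam 4 L s (j + 1)) x|)
      ≤ L ^ 2 * L ^ (2 * j) * (2 * (2 * (D * (32 * c * L ^ 4 * L ^ (2 * j))) +
          16 * L ^ 4 * L ^ (4 * j) * (A * D))) := by gcongr
    _ = 2 * L ^ 6 * (D * L ^ (4 * j)) * (64 * c + 16 * (A * L ^ (2 * j))) := by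
        have e4 : L ^ (4 * j) = L ^ (2 * j) * L ^ (2 * j) := by rw [← pow_add]; ring_nf
        rw [e4]; ring

/-- **`|π_j| ≤ KL⁶`** for all `m² ≥ 0`, `j` (`d = 4`, `L ≥ 2`).
[cite: BauerschmidtBrydgesSlade2015LogCorr, §6.1 (Assumption (A2) for π_j; [BBS-rg-pt] Lemma 6.1.2: π_j = L^{2(j+1)}π'_j = O(1) at d = 4)] -/
theorem abs_piPT_le : ∃ K : ℝ, 0 < K ∧ ∀ L : ℝ, 2 ≤ L → ∀ s : ℝ, 0 ≤ s → ∀ j : ℕ,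
    |piPT 4 L s j| ≤ K * L ^ 6 := by
  obtain ⟨c, hc, h⟩ := abs_Gam_four_le
  obtain ⟨cΔ, hcΔ, hΔ⟩ := abs_lapl_Gam_four_le
  refine ⟨2 * cΔ * (64 * c + 16 * c), by positivity, fun L hL s hs j => ?_⟩
  have hL0 : (0 : ℝ) < L := by linarith
  have hA0 : 0 ≤ c / L ^ (2 * j) := by positivity
  have hD0 : 0 ≤ cΔ / L ^ (4 * j) := by positivity
  have := abs_piPT_le_core hc h hL hs j hA0 hD0 (fun x => h L hL s hs j x) (fun x => hΔ L hL s hs j x)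
  have e1 : cΔ / L ^ (4 * j) * L ^ (4 * j) = cΔ := by field_simp
  have e2 : c / L ^ (2 * j) * L ^ (2 * j) = c := by field_simp
  rw [e1, e2] at this
  refine this.trans (le_of_eq ?_)
  ring

/-- **`|π_j| ≤ KL⁶(1+L^{2j}m²/(8+m²))^{-p}`** for `m² > 0` (every `p`): `π_j = O(χ_j)`.
[cite: BauerschmidtBrydgesSlade2015LogCorr, §6.1 (Assumption (A2): π_j = O(χ_j); [BBS-rg-pt] Lemma 6.1.2)] -/
theorem abs_piPT_le_decay (p : ℕ) : ∃ K : ℝ, 0 < K ∧ ∀ L : ℝ, 2 ≤ L → ∀ s : ℝ, 0 < s → ∀ j : ℕ,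
    |piPT 4 L s j| ≤ K * L ^ 6 * ((1 + L ^ (2 * j) * s / (8 + s)) ^ p)⁻¹ := by
  obtain ⟨c, hc, h⟩ := abs_Gam_four_le
  obtain ⟨cΔ, hcΔ, hΔ⟩ := abs_lapl_Gam_four_le_decay p
  refine ⟨2 * cΔ * (64 * c + 16 * c), by positivity, fun L hL s hs j => ?_⟩
  have hL0 : (0 : ℝ) < L := by linarith
  set ϑ : ℝ := ((1 + L ^ (2 * j) * s / (8 + s)) ^ p)⁻¹ with hϑdef
  have hϑ0 : 0 < ϑ := by positivity
  have hA0 : 0 ≤ c / L ^ (2 * j) := by positivity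
  have hD0 : 0 ≤ cΔ * ϑ / L ^ (4 * j) := by positivity
  have := abs_piPT_le_core hc h hL hs.le j hA0 hD0 (fun x => h L hL s hs.le j x) (fun x => hΔ L hL s hs j x)
  have e1 : cΔ * ϑ / L ^ (4 * j) * L ^ (4 * j) = cΔ * ϑ := by field_simp
  have e2 : c / L ^ (2 * j) * L ^ (2 * j) = c := by field_simp
  rw [e1, e2] at this
  refine this.trans (le_of_eq ?_)
  ring

end CTWSAW

end Literature.Barriers.CriticalPhenomena
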